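import Mathlib
import Literature.Geometry.Lorentzian.KerrSchildCoord
import Literature.Geometry.Lorentzian.KerrStarWaveOperator
import Literature.Geometry.Lorentzian.KerrDataSchwarzschildExtrinsic
import HarnessLib

/-!
# Route EternalPapapetrou · SchwarzschildExteriorModeRigidity — the Schwarzschild wave operator
# in Kerr–Schild coordinates

Helper file for item stmt-FinalStateConjecture-10039 (`SchwarzschildExteriorModeRigidity`).

For `a = 0` (`H = M/r`, `ℓ♯ = −∂₀ + x⃗/r`, `Σ = r²`) the frame form of
`∑ g^{μν} B(∂_μ, ∂_ν) + ∑ c^ν L(∂_ν)` (the coordinate wave operator, cf.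
`Literature.Barriers.FinalStateConjecture.Kerr.dalembertian_eq_hessian_add_firstOrder`):
`□_g Φ = −(1 + 2M/r) Φ₀₀ + (2M/r²)(D²Φ(∂₀, X) + D²Φ(X, ∂₀)) − (2M/r³) D²Φ(X, X) + Δₓ Φ
  + (2M/r²) Φ₀ − (2M/r³) DΦ(X)`, `X = (0, x⃗)`, `r = ‖x⃗‖`. [cite: KerrSchild1965, §2]
-/

set_option linter.dupNamespace false

noncomputable section

namespace Summit.FinalStateConjecture.FinalStateConjecture.Theorems

open Literature.Geometry.Lorentzian

namespace EternalPapapetrou.ModeRigidity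

/-- For `a = 0` the Kerr–Schild null vector is `ℓ♯ = −∂₀ + x⃗/‖x⃗‖` (off the axis). [folklore] -/
theorem nullVector_zero_eq {x : E4} (hx : E4.spatial x ≠ 0) :
    Kerr.nullVector 0 x = -E4.basisVector 0 + ‖E4.spatial x‖⁻¹ • E4.spaceEmbed (E4.spatial x) := by
  have hr : ‖E4.spatial x‖ ≠ 0 := norm_ne_zero_iff.2 hx
  have hrad : Kerr.radius 0 x = ‖E4.spatial x‖ := Kerr.radius_zero_eq_norm_spatial x
  ext μ
  fin_cases μ <;>
    simp [Kerr.nullVector, Kerr.nullCovectorFun, hrad, E4.ofTimeSpace_apply_zero] <;> field_simp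
  · show (E4.spatial x) 0 = x 1; rfl
  · show (E4.spatial x) 1 = x 2; rfl
  · show x 3 = (E4.spatial x) 2; rfl

/-- For `a = 0`, `Σ = ‖y‖²`. [folklore] -/
theorem blSigma_zero (y : E3) : Kerr.blSigma 0 y = ‖y‖ ^ 2 := by
  unfold Kerr.blSigma
  rw [Kerr.radius_zero_left, E4.spatialNorm_ofTimeSpace]
  ring

/-- **The Schwarzschild wave operator in Kerr–Schild coordinates, frame form**: for every
bilinear `B` and linear `L`, at a point off the axis,
`∑ g^{μν} B(∂_μ, ∂_ν) + ∑ c^ν L(∂_ν) = −(1 + 2M/r) B(∂₀, ∂₀) + (2M/r²)(B(∂₀, X) + B(X, ∂₀))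
 − (2M/r³) B(X, X) + ∑ᵢ B(∂ᵢ, ∂ᵢ) + (2M/r²) L(∂₀) − (2M/r³) L(X)`, `X = (0, x⃗)`, `r = ‖x⃗‖`.
[cite: KerrSchild1965, §2] -/
theorem schwarzschild_frame_form (M : ℝ) {x : E4} (hx : E4.spatial x ≠ 0)
    (B : E4 →L[ℝ] E4 →L[ℝ] ℝ) (L : E4 →L[ℝ] ℝ) :
    ∑ μ, ∑ ν, Kerr.inverseMetric M 0 x μ ν * B (E4.basisVector μ) (E4.basisVector ν) +
        ∑ ν, Kerr.divInverseMetric M 0 x ν * L (E4.basisVector ν) =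
      -(1 + 2 * M / ‖E4.spatial x‖) * B (E4.basisVector 0) (E4.basisVector 0) +
        2 * M / ‖E4.spatial x‖ ^ 2 *
          (B (E4.basisVector 0) (E4.spaceEmbed (E4.spatial x)) +
            B (E4.spaceEmbed (E4.spatial x)) (E4.basisVector 0)) -
        2 * M / ‖E4.spatial x‖ ^ 3 *
          B (E4.spaceEmbed (E4.spatial x)) (E4.spaceEmbed (E4.spatial x)) +
        ∑ i : Fin 3, B (E4.basisVector i.succ) (E4.basisVector i.succ) +
        2 * M / ‖E4.spatial x‖ ^ 2 * L (E4.basisVector 0) -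
        2 * M / ‖E4.spatial x‖ ^ 3 * L (E4.spaceEmbed (E4.spatial x)) := by
  have hr : ‖E4.spatial x‖ ≠ 0 := norm_ne_zero_iff.2 hx
  have hrad : Kerr.radius 0 x = ‖E4.spatial x‖ := Kerr.radius_zero_eq_norm_spatial x
  have hxr : 0 < Kerr.radius 0 x := by rw [hrad]; exact (norm_pos_iff.2 hx)
  rw [Kerr.sum_inverseMetric_mul_bilinForm, Kerr.sum_divInverseMetric_mul M 0 hxr,
    Kerr.scalarH_zero M hx, blSigma_zero, nullVector_zero_eq hx]
  simp only [map_add, map_neg, map_smul, add_apply,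
    neg_apply, FunLike.coe_smul, Pi.smul_apply, smul_eq_mul]
  field_simp
  ring

end EternalPapapetrou.ModeRigidity

end Summit.FinalStateConjecture.FinalStateConjecture.Theorems
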